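import Summits.BirchSwinnertonDyer.Rank1Residual.X11b.Three.KolyvaginShaExponentThree
import Literature.NumberTheory.EllipticCurves.ShaRestrictionIndex
import HarnessLib

/-!
# X11b @ 3 ∩ (KN₃)/ℚ: descent of the Kolyvagin telescope from `Ш(E/K)` to `Ш(E/ℚ)` —
# `Ш(E/ℚ)[3^∞]` finite (clause (ii) of `BSDp W 3` VERBATIM), `3^{2m} · Ш(E/ℚ)[3^∞] = 0`, and
# `3 ∤ y_K ⟹ Ш(E/ℚ)[3^∞] = 0`, from the FIVE cite-only inputs AT `3`

Cell `b2b-bsdres`, team x11b3 (N8/O2); seat x11b3-p2 GEN 36 ((P2-QUANT), ℚ-side companion of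
FILE 6 `X11b/Three/KolyvaginShaFiniteThreeClass` (p325613) and of `X11b/Three/KolyvaginShaExponentThree`
(this seat)).  Summit-side THEOREM-ONLY file (no definition, no named fact, no `sorry`); `K : Type`;
the literal prime `3`.

HONEST FRAMING (binding): **plumbing — COMPOSITIONS of tree theorems, nothing discharged.**  Every
Kolyvagin-side END of the cell concludes about `Ш(E/K)`, `K` the imaginary quadratic Heegner field,
while Miller's `BSD(E, 3)` (`BSDp W 3`, `BSDRootNumberSmallConductorProofs`) speaks of `Ш(E/ℚ)`:
its clause (ii) is `Finite (AddCommGroup.primaryComponent W.sha 3)`.  The passage is the tree's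
restriction theory (`ShaRestrictionIndex`, Serre *Galois Cohomology* I.§2.4; Kolyvagin, ICM 1990 §1:
*"The kernel of the natural homomorphism `Ш(E) → Ш(K, E)` is `Ш(E) ∩ H¹(G(K/ℚ), E(K)) ⊂ Ш(E)_2`"*):
`res : Ш(E/ℚ) → Ш(E_K/K)` is injective on `Ш(E/ℚ)[n]` for `n` prime to `[K : ℚ] = 2`
(`shaRestriction_eq_zero_iff_of_coprime`), hence injective on `Ш(E/ℚ)[3^∞]` and compatible with
multiplication by `3^e`.  §1 records this for any `X/ℚ`, any Galois `K/ℚ` and any `p ∤ [K : ℚ]`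
(finiteness and annihilation descend); §2 reads FILE 6's END
`Three.sha_primary_finite_three_of_classX11b_of_kodairaNeron_rat'` and this seat's
`Three.pow_smul_sha_three_primary_eq_zero_of_classX11b_of_kodairaNeron_rat'` /
`Three.sha_three_primary_eq_zero_of_classX11b_of_kodairaNeron_rat_of_not_dvd` through it: on
`ClassX11b W 3` ∩ (KN₃)/ℚ at `N = N_E`, for ANY imaginary quadratic `K` with the Heegner hypothesis
carrying a non-torsion Heegner point `P = y_K` — **`Ш(E/ℚ)[3^∞]` is finite** (clause (ii) of
`BSDp W 3`, token for token), **`3^{2m} · Ш(E/ℚ)[3^∞] = 0` whenever `3^{m+1} ∤ y_K` in `E(K)`**, and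
**`Ш(E/ℚ)[3^∞] = 0` whenever `3 ∤ y_K`** — CONDITIONAL on EXACTLY the FIVE cite-only inputs {`hPT`,
`hrec`, `hCM₃`, `h53₃`, `hγ₃`} + `hN` + (KN₃)/ℚ of FILE 6 (binders VERBATIM), NOT facts, NOT
discharged.  The existence of such `(K, y_K)` for `r_an(E/ℚ) = 1` (Gross–Zagier + a non-vanishing
twist) is NOT supplied here: `K`, `P` stay hypotheses of the conclusion, as in every END of the
lineage.  Clauses (i), (iii), (iv) of `BSDp W 3` are untouched; the named facts `kolyvagin`,
`Kolyvagin1990_padicValNat_card_sha_le` (`hKo`, `hB` of `bsdp_of_classX11b_three_of_onTreeInputs`)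
are NOT discharged; nothing booked; no mark / label / count / tier moves; node
`Three.HsiehDescentAt₃` and its FOUR antecedents untouched; #(KN₃) not asserted.

## What is proved

§1 (namespace `…X11b.KolyvaginAssembly`, any `X/ℚ`, `K/ℚ` Galois, `p ∤ [K : ℚ]`):
* `sha_primary_finite_of_baseChange_of_coprime` — `Ш(X_K/K)[p^∞]` finite ⟹ `Ш(X/ℚ)[p^∞]` finite;
* `pow_smul_sha_primary_eq_zero_of_baseChange_of_coprime` — `p^e Ш(X_K/K)[p^∞] = 0 ⟹ p^e Ш(X/ℚ)[p^∞] = 0`.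
§2 (namespace `…X11b.Three`, `ClassX11b W 3` ∩ (KN₃)/ℚ, FIVE labels + `hN`):
* `finite_primaryComponent_sha_three_of_classX11b_of_kodairaNeron_rat` — `Finite (AddCommGroup.primaryComponent W.sha 3)`;
* `pow_smul_sha_rat_three_primary_eq_zero_of_classX11b_of_kodairaNeron_rat` — `3^{m+1} ∤ y_K ⟹ 3^{2m} Ш(E/ℚ)[3^∞] = 0`;
* `primaryComponent_sha_three_eq_bot_of_classX11b_of_kodairaNeron_rat_of_not_dvd` — `3 ∤ y_K ⟹ Ш(E/ℚ)[3^∞] = ⊥`.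

## References

* [SerreGaloisCohomology1997] I.§2.4 (res ∘ cor); Kolyvagin, Proc. ICM Kyoto 1990, vol. I, §1 (read,
  galaxy panama:376007206895683 chunk 484); [Miller2011LMS] Def. 1.1; [McCallumLMS1991] §1 Theorem
  (Kolyvagin), Lemma 5.1; [GrossLMS1991] Thm. 1.3 (2), Prop. 2.1 (2).

presearch: "kernel of Ш(E/ℚ) → Ш(E/K) killed by [K:ℚ]" → tree `injOn_shaRestriction_torsionBy` /
`shaRestriction_eq_zero_iff_of_coprime` (`ShaRestrictionIndex`, used by `MatsunoCurvesRestriction`,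
`Additive/CyclotomicPrimeShaRestriction`); `lean search 'primaryComponent W.sha 3'` on X11b Kolyvagin
files → none; nothing minted.
-/

noncomputable section

open scoped Classical
open WeierstrassCurve Field NumberField IsDedekindDomain
open Literature.NumberTheory.EllipticCurves Literature.NumberTheory.GaloisRepresentations
open Literature.NumberTheory.EllipticCurves.Rank1Residual
open Literature.NumberTheory.EllipticCurves.RingClassField
open Literature.NumberTheory.EllipticCurves.ModularForms
open Literature.NumberTheory.DiophantineGeometry Literature.NumberTheory.DiophantineGeometry.TateAlgorithm
open Summit.BirchSwinnertonDyer.Rank1Residual.X11b.KolyvaginAssembly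

/-! ## §1 Restriction `Ш(X/ℚ) → Ш(X_K/K)` on `p`-primary parts, `p ∤ [K : ℚ]` -/

namespace Summit.BirchSwinnertonDyer.Rank1Residual.X11b.KolyvaginAssembly

variable (X : WeierstrassCurve ℚ) (K : Type) [Field K] [NumberField K] [IsGalois ℚ K] {p : ℕ}

/-- **`Ш(X_K/K)[p^∞]` finite ⟹ `Ш(X/ℚ)[p^∞]` finite** for `K/ℚ` Galois of degree prime to `p`:
restriction maps `Ш(X/ℚ)[p^∞]` into `Ш(X_K/K)[p^∞]` and is injective there, since a class `c`
killed by `p^j` with `res c = 0` satisfies `[K : ℚ]·c = 0` (`res ∘ cor`), `gcd(p^j, [K : ℚ]) = 1`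
(tree `shaRestriction_eq_zero_iff_of_coprime`). [cite: SerreGaloisCohomology1997, I.§2.4 Cor. to Prop. 9] -/
theorem sha_primary_finite_of_baseChange_of_coprime (hcop : p.Coprime (Module.finrank ℚ K))
    (h : Set.Finite {c : (X.baseChange K).sha | ∃ j : ℕ, p ^ j • c = 0}) :
    Set.Finite {c : X.sha | ∃ j : ℕ, p ^ j • c = 0} := by
  refine Set.Finite.of_finite_image (f := shaRestriction X K) (h.subset ?_) ?_
  · rintro _ ⟨c, ⟨j, hj⟩, rfl⟩
    exact ⟨j, by rw [← map_nsmul, hj, map_zero]⟩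
  · rintro c₁ ⟨j₁, hj₁⟩ c₂ ⟨j₂, hj₂⟩ heq
    have hn : (p ^ (j₁ + j₂)).Coprime (Module.finrank ℚ K) := Nat.Coprime.pow_left _ hcop
    have h1 : p ^ (j₁ + j₂) • c₁ = 0 := by rw [pow_add, mul_comm, mul_smul, hj₁, smul_zero]
    have h2 : p ^ (j₁ + j₂) • c₂ = 0 := by rw [pow_add, mul_smul, hj₂, smul_zero]
    have hkill : p ^ (j₁ + j₂) • (c₁ - c₂) = 0 := by rw [nsmul_sub, h1, h2, sub_zero]
    have h0 : shaRestriction X K (c₁ - c₂) = 0 := by rw [map_sub, heq, sub_self]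
    exact sub_eq_zero.mp ((shaRestriction_eq_zero_iff_of_coprime X K hn (c₁ - c₂) hkill).mp h0)

/-- **`p^e · Ш(X_K/K)[p^∞] = 0 ⟹ p^e · Ш(X/ℚ)[p^∞] = 0`** for `K/ℚ` Galois of degree prime to `p`:
`res (p^e c) = p^e res c = 0` and `p^e c ∈ Ш(X/ℚ)[p^j]`, on which `res` is injective
(`shaRestriction_eq_zero_iff_of_coprime`). [cite: SerreGaloisCohomology1997, I.§2.4 Cor. to Prop. 9] -/
theorem pow_smul_sha_primary_eq_zero_of_baseChange_of_coprime (hcop : p.Coprime (Module.finrank ℚ K))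
    {e : ℕ} (h : ∀ c' : (X.baseChange K).sha, (∃ j : ℕ, p ^ j • c' = 0) → p ^ e • c' = 0)
    (c : X.sha) (hc : ∃ j : ℕ, p ^ j • c = 0) : p ^ e • c = 0 := by
  obtain ⟨j, hj⟩ := hc
  have hup : p ^ e • shaRestriction X K c = 0 := h _ ⟨j, by rw [← map_nsmul, hj, map_zero]⟩
  have hn : (p ^ j).Coprime (Module.finrank ℚ K) := Nat.Coprime.pow_left _ hcop
  refine (shaRestriction_eq_zero_iff_of_coprime X K hn (p ^ e • c) ?_).mp ?_
  · rw [smul_comm, hj, smul_zero]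
  · rw [map_nsmul, hup]

end Summit.BirchSwinnertonDyer.Rank1Residual.X11b.KolyvaginAssembly

/-! ## §2 On `ClassX11b W 3` ∩ (KN₃)/ℚ: `Ш(E/ℚ)[3^∞]` -/

namespace Summit.BirchSwinnertonDyer.Rank1Residual.X11b.Three

-- `K : Type`: the tree's ring-class class field theory is universe `0`.
variable {K : Type} [Field K] [NumberField K] {N : ℕ} {W : WeierstrassCurve ℚ}

/-- **On the class X11b @ 3 ∩ (KN₃)/ℚ, `Ш(E/ℚ)[3^∞]` is finite — clause (ii) of Miller's
`BSD(E, 3)` (`BSDp W 3`) VERBATIM — from FIVE cite-only inputs AT `3`.**  FILE 6's END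
`sha_primary_finite_three_of_classX11b_of_kodairaNeron_rat'` (p325613: `Ш(E/K)[3^∞]` finite,
binders VERBATIM here) descended along `res : Ш(E/ℚ) → Ш(E_K/K)`, injective on `3`-primary parts
because `[K : ℚ] = 2` (`hK.1`; `K/ℚ` quadratic hence Galois) is prime to `3`
(`sha_primary_finite_of_baseChange_of_coprime`).  For `(E, 3) ∈ ClassX11b W 3` at `N = N_E` and
ANY `K : Type` imaginary quadratic with the Heegner hypothesis carrying a non-torsion Heegner point
`P`: `Finite (AddCommGroup.primaryComponent W.sha 3)`.  CONDITIONAL on EXACTLY {`hPT`, `hrec`,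
`hCM`, `h53`, `hγ`} at `3` + `hN` + (KN₃)/ℚ; cite-only, NOT discharged; `(K, P)` NOT supplied;
nothing booked; no mark / count / tier moves. [cite: Miller2011LMS, Def. 1.1 (ii)]
[cite: McCallumLMS1991, §1 Theorem (Kolyvagin)] [cite: SerreGaloisCohomology1997, I.§2.4] -/
theorem finite_primaryComponent_sha_three_of_classX11b_of_kodairaNeron_rat [NeZero N]
    [W.IsGloballyMinimal] (hW : ClassX11b W 3)
    (hPT : Literature.NumberTheory.GaloisCohomology.poitouTate_sum_localTatePairing_eq_zero K)
    (hN : ∀ [W.IsElliptic], N = W.conductorNorm ℤ)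
    (hrec : heegnerPointOfConductor_one_galoisConj N W K)
    (hCM : ∀ [W.IsElliptic] (_hK : IsImaginaryQuadratic K) (_hH : SatisfiesHeegnerHypothesis N K)
      (Dt : ModularParametrizationData W N) (β : ℤ) (ι : K →+* ℂ),
      (4 * N : ℤ) ∣ β ^ 2 - NumberField.discr K →
      ∀ {M : ℕ}, 1 ≤ M → ∀ (m : ℕ), Squarefree m →
      (∀ q ∈ m.primeFactors, IsKolyvaginPrime N W K 3 q ∧ FrobEqFrobInfty W K (3 ^ M) q) →
      ∃ y : (W.baseChange (ringClassField K ι m)).toAffine.Point,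
        WeierstrassCurve.Affine.Point.map (W' := W) (ringClassField K ι m).subtype.toRatAlgHom y =
          heegnerPointComplexOfConductor Dt (NumberField.discr K) β m)
    (h53 : ∀ [W.IsElliptic] (_hK : IsImaginaryQuadratic K) (_hH : SatisfiesHeegnerHypothesis N K)
      (Dt : ModularParametrizationData W N) (β : ℤ) (ι : K →+* ℂ) {M : ℕ}
      (_hM : 1 ≤ M) {n : ℕ} (_hn : Squarefree n)
      (_hKol : ∀ q ∈ n.primeFactors, IsKolyvaginPrime N W K 3 q ∧ FrobEqFrobInfty W K (3 ^ M) q)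
      (d : (m : ℕ) → m ∣ n → KolyvaginHeegnerData Dt β ι m) (m : ℕ) (hm : m ∣ n)
      (τm : ringClassField K ι m ≃ₐ[ℚ] ringClassField K ι m),
      (∀ x : ringClassField K ι m, ((τm x : ringClassField K ι m) : ℂ) = starRingEnd ℂ x) →
      ∃ σ' ∈ ringClassGal ι m, IsOfFinAddOrder
        (pointGalHom W (ringClassField K ι m) τm (d m hm).y -
          (-W.rootNumber) • pointGalHom W (ringClassField K ι m) σ' (d m hm).y))
    (hKN3m : ∀ [W.IsElliptic] (v : HeightOneSpectrum (𝓞 ℚ)),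
      W.HasMultiplicativeReductionAt v → ¬ 3 ∣ W.ordMinimalDiscriminant v)
    (hKN3a : ∀ [W.IsElliptic] (v : HeightOneSpectrum (𝓞 ℚ)), W.HasAdditiveReductionAt v →
      W.kodairaSymbolAt v ≠ KodairaSymbol.IV ∧ W.kodairaSymbolAt v ≠ KodairaSymbol.IVstar)
    (hγ : ∀ [W.IsElliptic] (_hK : IsImaginaryQuadratic K) (_hH : SatisfiesHeegnerHypothesis N K)
      (Dt : ModularParametrizationData W N) (β : ℤ) (ι : K →+* ℂ) {M : ℕ}
      (_hM : 1 ≤ M) {n : ℕ} (_hn : Squarefree n)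
      (_hKol : ∀ q ∈ n.primeFactors, IsKolyvaginPrime N W K 3 q ∧ FrobEqFrobInfty W K (3 ^ M) q)
      (d : (m : ℕ) → m ∣ n → KolyvaginHeegnerData Dt β ι m)
      (m : ℕ) (hm : m ∣ n) (ℓ : ℕ) (hℓ : ℓ ∈ m.primeFactors) [Fact ℓ.Prime]
      (hΔ : ¬ (ℓ : ℤ) ∣ minimalDiscriminantInt W) (φ₀ : absoluteGaloisGroup (ZMod ℓ)),
      (∀ x : AlgebraicClosure (ZMod ℓ), φ₀ • x = x ^ ℓ) →
      ∀ (hle : ringClassField K ι (m / ℓ) ≤ ringClassField K ι m)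
        (γ : ringClassField K ι m ≃ₐ[ℚ] ringClassField K ι m), γ ∈ ringClassGal ι m →
        geomReduction hΔ ((RatClosure.pointsEquiv (K := K) W).symm
            ((d m hm).toGeomPoints (pointGalHom W (ringClassField K ι m) γ (d m hm).y))) =
          φ₀ • geomReduction hΔ ((RatClosure.pointsEquiv (K := K) W).symm
            ((d m hm).toGeomPoints (pointGalHom W (ringClassField K ι m) γ
              (WeierstrassCurve.Affine.Point.map (W' := W)
                ((RingClassField.inclusion ι hle).restrictScalars ℚ)
                (d (m / ℓ)
                  ((Nat.div_dvd_of_dvd (Nat.dvd_of_mem_primeFactors hℓ)).trans hm)).y))))) :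
    ∀ [W.IsElliptic] (_hK : IsImaginaryQuadratic K) (_hH : SatisfiesHeegnerHypothesis N K)
      {P : (W.baseChange K).toAffine.Point} (_hP : IsHeegnerPoint N W K P)
      (_hnt : ¬ IsOfFinAddOrder P), Finite (AddCommGroup.primaryComponent W.sha 3) := by
  intro _ hK hH P hP hnt
  haveI : Algebra.IsQuadraticExtension ℚ K := ⟨hK.1⟩
  have h3 : (3 : ℕ).Coprime (Module.finrank ℚ K) := by rw [hK.1]; decide
  exact (sha_primary_finite_of_baseChange_of_coprime W K h3
    (sha_primary_finite_three_of_classX11b_of_kodairaNeron_rat' hW hPT hN hrec hCM h53 hKN3m hKN3a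
      hγ hK hH hP hnt)).to_subtype

/-- **On the class X11b @ 3 ∩ (KN₃)/ℚ, `3^{2m} · Ш(E/ℚ)[3^∞] = 0` for every `m` with
`3^{m+1} ∤ y_K` in `E(K)`, from FIVE cite-only inputs AT `3`** —
`pow_smul_sha_three_primary_eq_zero_of_classX11b_of_kodairaNeron_rat'` (this seat; `Ш(E/K)`)
descended along `res : Ш(E/ℚ) → Ш(E_K/K)` (`pow_smul_sha_primary_eq_zero_of_baseChange_of_coprime`,
`[K : ℚ] = 2` prime to `3`).  Same binders (FILE 6's, VERBATIM); conclusion over `c : Ш(E/ℚ)`.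
The EXPONENT form over `ℚ` of McCallum's §1 Theorem (Kolyvagin) with Lemma 5.1; the ORDER form is
NOT obtained.  CONDITIONAL on EXACTLY {`hPT`, `hrec`, `hCM`, `h53`, `hγ`} at `3` + `hN` + (KN₃)/ℚ;
cite-only, NOT discharged; nothing booked; no mark.
[cite: McCallumLMS1991, §1 Theorem (Kolyvagin), Lemma 5.1] [cite: SerreGaloisCohomology1997, I.§2.4] -/
theorem pow_smul_sha_rat_three_primary_eq_zero_of_classX11b_of_kodairaNeron_rat [NeZero N]
    [W.IsGloballyMinimal] (hW : ClassX11b W 3)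
    (hPT : Literature.NumberTheory.GaloisCohomology.poitouTate_sum_localTatePairing_eq_zero K)
    (hN : ∀ [W.IsElliptic], N = W.conductorNorm ℤ)
    (hrec : heegnerPointOfConductor_one_galoisConj N W K)
    (hCM : ∀ [W.IsElliptic] (_hK : IsImaginaryQuadratic K) (_hH : SatisfiesHeegnerHypothesis N K)
      (Dt : ModularParametrizationData W N) (β : ℤ) (ι : K →+* ℂ),
      (4 * N : ℤ) ∣ β ^ 2 - NumberField.discr K →
      ∀ {M : ℕ}, 1 ≤ M → ∀ (m : ℕ), Squarefree m →
      (∀ q ∈ m.primeFactors, IsKolyvaginPrime N W K 3 q ∧ FrobEqFrobInfty W K (3 ^ M) q) →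
      ∃ y : (W.baseChange (ringClassField K ι m)).toAffine.Point,
        WeierstrassCurve.Affine.Point.map (W' := W) (ringClassField K ι m).subtype.toRatAlgHom y =
          heegnerPointComplexOfConductor Dt (NumberField.discr K) β m)
    (h53 : ∀ [W.IsElliptic] (_hK : IsImaginaryQuadratic K) (_hH : SatisfiesHeegnerHypothesis N K)
      (Dt : ModularParametrizationData W N) (β : ℤ) (ι : K →+* ℂ) {M : ℕ}
      (_hM : 1 ≤ M) {n : ℕ} (_hn : Squarefree n)
      (_hKol : ∀ q ∈ n.primeFactors, IsKolyvaginPrime N W K 3 q ∧ FrobEqFrobInfty W K (3 ^ M) q)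
      (d : (m : ℕ) → m ∣ n → KolyvaginHeegnerData Dt β ι m) (m : ℕ) (hm : m ∣ n)
      (τm : ringClassField K ι m ≃ₐ[ℚ] ringClassField K ι m),
      (∀ x : ringClassField K ι m, ((τm x : ringClassField K ι m) : ℂ) = starRingEnd ℂ x) →
      ∃ σ' ∈ ringClassGal ι m, IsOfFinAddOrder
        (pointGalHom W (ringClassField K ι m) τm (d m hm).y -
          (-W.rootNumber) • pointGalHom W (ringClassField K ι m) σ' (d m hm).y))
    (hKN3m : ∀ [W.IsElliptic] (v : HeightOneSpectrum (𝓞 ℚ)),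
      W.HasMultiplicativeReductionAt v → ¬ 3 ∣ W.ordMinimalDiscriminant v)
    (hKN3a : ∀ [W.IsElliptic] (v : HeightOneSpectrum (𝓞 ℚ)), W.HasAdditiveReductionAt v →
      W.kodairaSymbolAt v ≠ KodairaSymbol.IV ∧ W.kodairaSymbolAt v ≠ KodairaSymbol.IVstar)
    (hγ : ∀ [W.IsElliptic] (_hK : IsImaginaryQuadratic K) (_hH : SatisfiesHeegnerHypothesis N K)
      (Dt : ModularParametrizationData W N) (β : ℤ) (ι : K →+* ℂ) {M : ℕ}
      (_hM : 1 ≤ M) {n : ℕ} (_hn : Squarefree n)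
      (_hKol : ∀ q ∈ n.primeFactors, IsKolyvaginPrime N W K 3 q ∧ FrobEqFrobInfty W K (3 ^ M) q)
      (d : (m : ℕ) → m ∣ n → KolyvaginHeegnerData Dt β ι m)
      (m : ℕ) (hm : m ∣ n) (ℓ : ℕ) (hℓ : ℓ ∈ m.primeFactors) [Fact ℓ.Prime]
      (hΔ : ¬ (ℓ : ℤ) ∣ minimalDiscriminantInt W) (φ₀ : absoluteGaloisGroup (ZMod ℓ)),
      (∀ x : AlgebraicClosure (ZMod ℓ), φ₀ • x = x ^ ℓ) →
      ∀ (hle : ringClassField K ι (m / ℓ) ≤ ringClassField K ι m)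
        (γ : ringClassField K ι m ≃ₐ[ℚ] ringClassField K ι m), γ ∈ ringClassGal ι m →
        geomReduction hΔ ((RatClosure.pointsEquiv (K := K) W).symm
            ((d m hm).toGeomPoints (pointGalHom W (ringClassField K ι m) γ (d m hm).y))) =
          φ₀ • geomReduction hΔ ((RatClosure.pointsEquiv (K := K) W).symm
            ((d m hm).toGeomPoints (pointGalHom W (ringClassField K ι m) γ
              (WeierstrassCurve.Affine.Point.map (W' := W)
                ((RingClassField.inclusion ι hle).restrictScalars ℚ)
                (d (m / ℓ)
                  ((Nat.div_dvd_of_dvd (Nat.dvd_of_mem_primeFactors hℓ)).trans hm)).y))))) :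
    ∀ [W.IsElliptic] (_hK : IsImaginaryQuadratic K) (_hH : SatisfiesHeegnerHypothesis N K)
      {P : (W.baseChange K).toAffine.Point} (_hP : IsHeegnerPoint N W K P)
      (_hnt : ¬ IsOfFinAddOrder P) {m : ℕ}
      (_hm : ∀ Q : (W.baseChange K).toAffine.Point, 3 ^ (m + 1) • Q ≠ P) (c : W.sha),
      (∃ j : ℕ, 3 ^ j • c = 0) → 3 ^ (2 * m) • c = 0 := by
  intro _ hK hH P hP hnt m hm
  haveI : Algebra.IsQuadraticExtension ℚ K := ⟨hK.1⟩
  have h3 : (3 : ℕ).Coprime (Module.finrank ℚ K) := by rw [hK.1]; decide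
  exact pow_smul_sha_primary_eq_zero_of_baseChange_of_coprime W K h3
    (pow_smul_sha_three_primary_eq_zero_of_classX11b_of_kodairaNeron_rat' hW hPT hN hrec hCM h53
      hKN3m hKN3a hγ hK hH hP hnt hm)

/-- **On the class X11b @ 3 ∩ (KN₃)/ℚ: `3 ∤ y_K` in `E(K)` ⟹ `Ш(E/ℚ)[3^∞] = 0`** (as Mathlib's
`AddCommGroup.primaryComponent W.sha 3 = ⊥`), from FIVE cite-only inputs AT `3` — the case
`m = 0` of `pow_smul_sha_rat_three_primary_eq_zero_of_classX11b_of_kodairaNeron_rat` (Gross 1991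
Prop. 2.1 (2) at `p = 3`, descended to `ℚ`).  Same binders; CONDITIONAL on EXACTLY {`hPT`, `hrec`,
`hCM`, `h53`, `hγ`} at `3` + `hN` + (KN₃)/ℚ; cite-only, NOT discharged; nothing booked; no mark.
[cite: GrossLMS1991, Prop. 2.1 (2)] [cite: SerreGaloisCohomology1997, I.§2.4] -/
theorem primaryComponent_sha_three_eq_bot_of_classX11b_of_kodairaNeron_rat_of_not_dvd [NeZero N]
    [W.IsGloballyMinimal] (hW : ClassX11b W 3)
    (hPT : Literature.NumberTheory.GaloisCohomology.poitouTate_sum_localTatePairing_eq_zero K)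
    (hN : ∀ [W.IsElliptic], N = W.conductorNorm ℤ)
    (hrec : heegnerPointOfConductor_one_galoisConj N W K)
    (hCM : ∀ [W.IsElliptic] (_hK : IsImaginaryQuadratic K) (_hH : SatisfiesHeegnerHypothesis N K)
      (Dt : ModularParametrizationData W N) (β : ℤ) (ι : K →+* ℂ),
      (4 * N : ℤ) ∣ β ^ 2 - NumberField.discr K →
      ∀ {M : ℕ}, 1 ≤ M → ∀ (m : ℕ), Squarefree m →
      (∀ q ∈ m.primeFactors, IsKolyvaginPrime N W K 3 q ∧ FrobEqFrobInfty W K (3 ^ M) q) →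
      ∃ y : (W.baseChange (ringClassField K ι m)).toAffine.Point,
        WeierstrassCurve.Affine.Point.map (W' := W) (ringClassField K ι m).subtype.toRatAlgHom y =
          heegnerPointComplexOfConductor Dt (NumberField.discr K) β m)
    (h53 : ∀ [W.IsElliptic] (_hK : IsImaginaryQuadratic K) (_hH : SatisfiesHeegnerHypothesis N K)
      (Dt : ModularParametrizationData W N) (β : ℤ) (ι : K →+* ℂ) {M : ℕ}
      (_hM : 1 ≤ M) {n : ℕ} (_hn : Squarefree n)
      (_hKol : ∀ q ∈ n.primeFactors, IsKolyvaginPrime N W K 3 q ∧ FrobEqFrobInfty W K (3 ^ M) q)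
      (d : (m : ℕ) → m ∣ n → KolyvaginHeegnerData Dt β ι m) (m : ℕ) (hm : m ∣ n)
      (τm : ringClassField K ι m ≃ₐ[ℚ] ringClassField K ι m),
      (∀ x : ringClassField K ι m, ((τm x : ringClassField K ι m) : ℂ) = starRingEnd ℂ x) →
      ∃ σ' ∈ ringClassGal ι m, IsOfFinAddOrder
        (pointGalHom W (ringClassField K ι m) τm (d m hm).y -
          (-W.rootNumber) • pointGalHom W (ringClassField K ι m) σ' (d m hm).y))
    (hKN3m : ∀ [W.IsElliptic] (v : HeightOneSpectrum (𝓞 ℚ)),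
      W.HasMultiplicativeReductionAt v → ¬ 3 ∣ W.ordMinimalDiscriminant v)
    (hKN3a : ∀ [W.IsElliptic] (v : HeightOneSpectrum (𝓞 ℚ)), W.HasAdditiveReductionAt v →
      W.kodairaSymbolAt v ≠ KodairaSymbol.IV ∧ W.kodairaSymbolAt v ≠ KodairaSymbol.IVstar)
    (hγ : ∀ [W.IsElliptic] (_hK : IsImaginaryQuadratic K) (_hH : SatisfiesHeegnerHypothesis N K)
      (Dt : ModularParametrizationData W N) (β : ℤ) (ι : K →+* ℂ) {M : ℕ}
      (_hM : 1 ≤ M) {n : ℕ} (_hn : Squarefree n)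
      (_hKol : ∀ q ∈ n.primeFactors, IsKolyvaginPrime N W K 3 q ∧ FrobEqFrobInfty W K (3 ^ M) q)
      (d : (m : ℕ) → m ∣ n → KolyvaginHeegnerData Dt β ι m)
      (m : ℕ) (hm : m ∣ n) (ℓ : ℕ) (hℓ : ℓ ∈ m.primeFactors) [Fact ℓ.Prime]
      (hΔ : ¬ (ℓ : ℤ) ∣ minimalDiscriminantInt W) (φ₀ : absoluteGaloisGroup (ZMod ℓ)),
      (∀ x : AlgebraicClosure (ZMod ℓ), φ₀ • x = x ^ ℓ) →
      ∀ (hle : ringClassField K ι (m / ℓ) ≤ ringClassField K ι m)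
        (γ : ringClassField K ι m ≃ₐ[ℚ] ringClassField K ι m), γ ∈ ringClassGal ι m →
        geomReduction hΔ ((RatClosure.pointsEquiv (K := K) W).symm
            ((d m hm).toGeomPoints (pointGalHom W (ringClassField K ι m) γ (d m hm).y))) =
          φ₀ • geomReduction hΔ ((RatClosure.pointsEquiv (K := K) W).symm
            ((d m hm).toGeomPoints (pointGalHom W (ringClassField K ι m) γ
              (WeierstrassCurve.Affine.Point.map (W' := W)
                ((RingClassField.inclusion ι hle).restrictScalars ℚ)
                (d (m / ℓ)
                  ((Nat.div_dvd_of_dvd (Nat.dvd_of_mem_primeFactors hℓ)).trans hm)).y))))) :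
    ∀ [W.IsElliptic] (_hK : IsImaginaryQuadratic K) (_hH : SatisfiesHeegnerHypothesis N K)
      {P : (W.baseChange K).toAffine.Point} (_hP : IsHeegnerPoint N W K P)
      (_hnt : ¬ IsOfFinAddOrder P) (_h3 : ∀ Q : (W.baseChange K).toAffine.Point, 3 • Q ≠ P),
      AddCommGroup.primaryComponent W.sha 3 = ⊥ := by
  intro _ hK hH P hP hnt h3
  refine eq_bot_iff.mpr fun c hc ↦ ?_
  have h := pow_smul_sha_rat_three_primary_eq_zero_of_classX11b_of_kodairaNeron_rat hW hPT hN hrec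
    hCM h53 hKN3m hKN3a hγ hK hH hP hnt (m := 0) (fun Q ↦ by simpa using h3 Q) c
    ((AddCommGroup.mem_primaryComponent).mp hc)
  simpa using h

end Summit.BirchSwinnertonDyer.Rank1Residual.X11b.Three

end
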